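import Literature.NumberTheory.DiophantineGeometry.CatalanPiAdicLemmas
import Literature.NumberTheory.DiophantineGeometry.CatalanNagell
import Mathlib.NumberTheory.NumberField.Cyclotomic.PID
import HarnessLib

/-!
# Mihăilescu's Theorem IV for the prime 5 [Schoof2009, Chapter 8]

[Schoof2009, Theorem 8.3] (P. Mihăilescu): *for distinct odd primes `p, q` and a non-zero solution of
Catalan's equation `x^p - y^q = 1`, the minus component `(x - ζ_p)^{1-ι}` is a non-trivial element of
the obstruction group `H`*; hence ([Schoof2009, Corollary 8.4]) there is no non-zero solution when
`q ∤ h_p⁻`, and in particular ([Schoof2009, Theorem IV and p. 52]) none when `p` or `q` is `3` or `5`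
(`h_3⁻ = h_5⁻ = 1`). We prove Theorem 8.3 in the case that is needed, `ℤ[ζ_p]` a principal ideal
domain (then `H⁻` is trivial, i.e. `(x - ζ_p)/(x - ζ_p⁻¹)` *is* a `q`-th power, and Theorem 8.3 says
this is impossible), and deduce that a non-zero solution has `p, q ≥ 7`:

* `Catalan.PiAdic.exists_nu_A_B` — [Schoof2009, Proposition 8.1] in integral form: in the PID case a
  solution yields `ν, A, B ∈ ℤ[ζ_p]` and a unit `U` with `x - 1 = πν`, `A^q = ζ U (1 - ν)`,
  `B^q = -U(ζν + 1)` (so `α = A/B` has `α^q = (x - ζ)/(x - ζ⁻¹)`), `A ≡ -B (mod π)`, `π ∤ B`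
  (and `A - B` is a unit: `A^q - B^q = U(1 + ζ)`, [Schoof2009, Proposition 8.1 (ii)]);
* `Catalan.PiAdic.stage_one` — [Schoof2009, Proposition 8.2]: these data force `q ≡ 1 (mod p)`
  (the norm of Schoof's unit `η = (w - w')^q` computed modulo `(x-1)π`, with the `p`-adic `q`-th
  roots `w, w'` replaced by the truncated Taylor polynomials `q ∓ ν`, resp. their twists, and the
  uniqueness of `q`-th roots modulo powers of `π`);
* `Catalan.PiAdic.stage_two` — [Schoof2009, Theorem 8.3]: and then, computing modulo `μ³`, a
  contradiction (`p^{q-1} ∣ q - 1`), for `p ≥ 5`;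
* `Catalan.PiAdic.no_solution_of_isPrincipalIdealRing` — **[Schoof2009, Corollary 8.4] (PID case)**:
  for an odd prime `p ≥ 5` with `ℤ[ζ_p]` a PID and any odd prime `q`, `x^p - y^q = 1` has no solution
  in non-zero integers;
* `Catalan.PiAdic.seven_le` — **[Schoof2009, Theorem IV for `3` and `5`]**: a non-zero solution with
  odd prime exponents has `p, q ≥ 7` (the prime `3` by Nagell's theorem `Catalan.Nagell.five_le`, the
  prime `5` by the above with Mathlib's `IsCyclotomicExtension.Rat.five_pid`, and the symmetry
  `(x, y, p, q) ↦ (-y, -x, q, p)`).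

Everything is proved; no definitions, no named facts.

## References

* R. Schoof, *Catalan's Conjecture*, Universitext, Springer 2009 [Schoof2009], Chapter 8:
  Propositions 8.1, 8.2, Theorem 8.3, Corollary 8.4, Theorem IV (book pp. 47–52) — held,
  `lit read book:schoof2009-catalan-s-conjecture` (PDF pp. 126–131).
* P. Mihăilescu, *Primary cyclotomic units and a proof of Catalan's conjecture*, J. reine angew.
  Math. **572** (2004), 167–195 [Mihailescu2004].
* Y. Bugeaud, G. Hanrot, *Un nouveau critère pour l'équation de Catalan*, Mathematika **47** (2000),
  63–73 (the weaker predecessor of Theorem 8.3 cited in [Schoof2009, Ch. 8]).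
-/

namespace Literature.NumberTheory.DiophantineGeometry

namespace Catalan.PiAdic

open NumberField IsCyclotomicExtension Finset
open Literature.NumberTheory.NumberFields.Stickelberger Catalan.Minus

section WithZeta

variable {p : ℕ} [hp : Fact p.Prime] {K : Type*} [Field K] [NumberField K]
  [hK : IsCyclotomicExtension {p} ℚ K] {ζ : K} (hζ : IsPrimitiveRoot ζ p)

/-! ### Small helpers -/

section Helpers

variable {R : Type*} [CommRing R]

/-- products of signs are signs. [folklore] -/
theorem sign_mul {s t : R} (hs : s = 1 ∨ s = -1) (ht : t = 1 ∨ t = -1) :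
    s * t = 1 ∨ s * t = -1 := by
  rcases hs with rfl | rfl <;> rcases ht with rfl | rfl <;> simp

/-- powers of signs are signs. [folklore] -/
theorem sign_pow {s : R} (hs : s = 1 ∨ s = -1) (n : ℕ) : s ^ n = 1 ∨ s ^ n = -1 := by
  rcases hs with rfl | rfl
  · simp
  · rcases neg_one_pow_eq_or R n with h | h <;> simp [h]

/-- a sign squares to one. [folklore] -/
theorem sign_mul_self {s : R} (hs : s = 1 ∨ s = -1) : s * s = 1 := by
  rcases hs with rfl | rfl <;> simp

/-- **the scaled Taylor polynomial of the `q`-th root to order three**: with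
`V(t) = 2q² + 2q t + (1-q) t²` (`= 2q² · (1 + t/q + C(1/q,2) t²)`) one has
`V(t)^q ≡ (2q²)^q (1 + t) (mod t³)`. [cite: Schoof2009, Ch. 8 (p. 51), Exercise 8.2] -/
theorem exists_taylor_three_pow {q : ℕ} (hq : 2 ≤ q) (t : R) :
    ∃ Rm : R, ((2 * q ^ 2 : ℕ) + (2 * q : ℕ) * t + (1 - (q : R)) * t ^ 2) ^ q =
      ((2 * q ^ 2 : ℕ) : R) ^ q * (1 + t) + t ^ 3 * Rm := by
  obtain ⟨m, rfl⟩ : ∃ m, q = m + 2 := ⟨q - 2, by omega⟩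
  set X : R := ((2 * (m + 2) ^ 2 : ℕ) : R) with hX
  set L : R := ((2 * (m + 2) : ℕ) : R) + (1 - ((m + 2 : ℕ) : R)) * t with hL
  obtain ⟨Z, hZ⟩ := exists_add_pow_eq_order_three X (t * L) m
  -- the binomial coefficient `C(q,2) · 2 = q (q-1)`
  have hC : (((m + 2).choose 2 : ℕ) : R) * 2 = ((m + 2 : ℕ) : R) * (((m + 2 : ℕ) : R) - 1) := by
    have h1 : (m + 2).choose 2 * 2 = (m + 2) * (m + 1) := by
      rw [Nat.choose_two_right, show m + 2 - 1 = m + 1 from rfl]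
      exact Nat.div_mul_cancel (by rw [mul_comm]; exact (Nat.even_mul_succ_self (m + 1)).two_dvd)
    have h2 := congrArg (Nat.cast : ℕ → R) h1
    push_cast at h2 ⊢
    linear_combination h2
  refine ⟨(((m + 2).choose 2 : ℕ) : R) * X ^ m *
      (2 * ((2 * (m + 2) : ℕ) : R) * (1 - ((m + 2 : ℕ) : R)) + (1 - ((m + 2 : ℕ) : R)) ^ 2 * t)
      + L ^ 3 * Z, ?_⟩
  have e : X + ((2 * (m + 2) : ℕ) : R) * t + (1 - ((m + 2 : ℕ) : R)) * t ^ 2 = X + t * L := by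
    rw [hL]; ring
  rw [e, hZ, hL, hX]
  push_cast
  push_cast at hC
  linear_combination (2 * ((m : R) + 2) ^ 2 * (2 * ((m : R) + 2) ^ 2) ^ m * t ^ 2) * hC

end Helpers

/-! ### The norm bookkeeping shared by the two stages -/

section Core

/-- `N(1) = 1`. [folklore] -/
theorem normO_one : normO (1 : 𝓞 K) = 1 := by
  simpa using normO_natCast (K := K) 1

include hζ in
/-- **Expansion of a norm** `N(a + c d) ≡ a^{|G|} + a^{|G|-1} c Tr(d) (mod π^{2k})` for integers
`a, c` and `π^k ∣ c d`. [cite: Schoof2009, Ch. 8 (pp. 49–51, the computation of `N(u)`)] -/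
theorem pow_dvd_normO_add_mul_sub {a c : ℤ} {d : 𝓞 K} {k : ℕ}
    (hcd : (hζ.toInteger - 1) ^ k ∣ (c : 𝓞 K) * d) :
    (hζ.toInteger - 1) ^ (2 * k) ∣ normO ((a : 𝓞 K) + (c : 𝓞 K) * d) -
      ((a : 𝓞 K) ^ Fintype.card Gal(K/ℚ) +
        (a : 𝓞 K) ^ (Fintype.card Gal(K/ℚ) - 1) * (c : 𝓞 K) * traceO d) := by
  classical
  have hmem : ∀ σ ∈ (Finset.univ : Finset Gal(K/ℚ)),
      (c : 𝓞 K) * σ • d ∈ Ideal.span {(hζ.toInteger - 1) ^ k} := by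
    intro σ _
    rw [Ideal.mem_span_singleton, show (c : 𝓞 K) * σ • d = σ • ((c : 𝓞 K) * d) by
      rw [smul_mul', gal_smul_intCast]]
    exact pow_dvd_gal_smul hζ σ hcd
  have h := prod_add_sub_mem_sq Finset.univ (a : 𝓞 K) (fun σ => (c : 𝓞 K) * σ • d) _ hmem
  rw [Ideal.span_singleton_pow, ← pow_mul, Ideal.mem_span_singleton, Finset.card_univ,
    mul_comm k 2] at h
  have e1 : normO ((a : 𝓞 K) + (c : 𝓞 K) * d) = ∏ σ : Gal(K/ℚ), ((a : 𝓞 K) + (c : 𝓞 K) * σ • d) := by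
    unfold normO
    exact Finset.prod_congr rfl fun σ _ => by rw [smul_add, smul_mul', gal_smul_intCast, gal_smul_intCast]
  have e2 : ∑ σ : Gal(K/ℚ), (c : 𝓞 K) * σ • d = (c : 𝓞 K) * traceO d := by
    unfold traceO; rw [Finset.mul_sum]
  rw [e1, mul_assoc _ (c : 𝓞 K), ← e2]
  exact h

include hζ in
/-- **The common norm computation of [Schoof2009, Proposition 8.2 and Theorem 8.3]**: if
`(A - B) W ≡ A u (mod π^N)` with `A - B` a unit, `W^q ≡ a_q (1 - ν) (mod π^N)`,
`A^q = U'(1 - ν)` with `U'` a unit and `π ∣ ν`, then taking norms and `q`-th powers,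
`s N(a_q) ≡ s' N(u)^q (mod π^N)` for signs `s = N(A-B)^q`, `s' = N(U')` (the factor
`N(1 - ν) ≡ 1` cancels). [cite: Schoof2009, Proposition 8.2 (proof), Theorem 8.3 (proof)] -/
theorem core {q N : ℕ} {A B W u aq ν : 𝓞 K} {U' : (𝓞 K)ˣ}
    (h1 : (hζ.toInteger - 1) ^ N ∣ (A - B) * W - A * u) (hAB : IsUnit (A - B))
    (hW : (hζ.toInteger - 1) ^ N ∣ W ^ q - aq * (1 - ν)) (hA : A ^ q = U' * (1 - ν))
    (hπν : hζ.toInteger - 1 ∣ ν) :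
    ∃ s s' : 𝓞 K, (s = 1 ∨ s = -1) ∧ (s' = 1 ∨ s' = -1) ∧
      (hζ.toInteger - 1) ^ N ∣ s * normO aq - s' * normO u ^ q := by
  haveI := IsCyclotomicExtension.isGalois {p} ℚ K
  set π := hζ.toInteger - 1 with hπ
  have hπp : Prime π := prime_zeta_sub_one hζ
  have e1 : π ^ N ∣ normO ((A - B) * W) - normO (A * u) := pow_dvd_normO_sub hζ h1
  rw [normO_mul, normO_mul] at e1
  have e2 : π ^ N ∣ (normO (A - B) * normO W) ^ q - (normO A * normO u) ^ q :=
    e1.trans (sub_dvd_pow_sub_pow _ _ q)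
  rw [mul_pow, mul_pow, ← normO_pow W, ← normO_pow A, hA, normO_mul] at e2
  have e3 : π ^ N ∣ normO (W ^ q) - normO (aq * (1 - ν)) := pow_dvd_normO_sub hζ hW
  rw [normO_mul] at e3
  -- the signs
  have hs : normO (A - B) ^ q = 1 ∨ normO (A - B) ^ q = -1 := sign_pow (normO_of_isUnit hAB) q
  have hs' : normO (U' : 𝓞 K) = 1 ∨ normO (U' : 𝓞 K) = -1 := normO_of_isUnit U'.isUnit
  -- `π ∤ N(1 - ν)`
  have e4 : π ∣ normO (1 - ν) - 1 := by
    have h := pow_dvd_normO_sub hζ (n := 1) (X := 1 - ν) (Y := 1)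
      (by rw [pow_one, sub_sub_cancel_left]; exact dvd_neg.mpr hπν)
    rwa [pow_one, normO_one] at h
  have e5 : ¬ π ∣ normO (1 - ν) := fun h => hπp.not_unit (isUnit_of_dvd_one (by
    have := dvd_sub h e4; rwa [sub_sub_cancel] at this))
  refine ⟨normO (A - B) ^ q, normO (U' : 𝓞 K), hs, hs', hπp.pow_dvd_of_dvd_mul_left N e5 ?_⟩
  have := dvd_sub e2 (e3.mul_left (normO (A - B) ^ q))
  have e : normO (A - B) ^ q * normO (W ^ q) - normO (U' : 𝓞 K) * normO (1 - ν) * normO u ^ q -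
      normO (A - B) ^ q * (normO (W ^ q) - normO aq * normO (1 - ν)) =
      normO (1 - ν) * (normO (A - B) ^ q * normO aq - normO (U' : 𝓞 K) * normO u ^ q) := by ring
  rwa [e] at this

end Core

/-! ### Proposition 8.1: the data `ν, A, B` of a solution when `ℤ[ζ_p]` is principal -/

section Data

include hζ in
/-- **[Schoof2009, Proposition 8.1] in the PID case, integral form.** Let `p ≠ q` be odd primes with
`ℤ[ζ_p] = 𝓞 K` a PID, and let `x ≠ 1` satisfy Cassels' relations `∑_{i<p} x^i = p v^q`,
`p ∣ x - 1` (any non-zero solution of `x^p - y^q = 1` does). Then `(x - ζ) = π 𝔟^q` with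
`𝔟 = (γ)` principal, and with `ι` = complex conjugation, `B = ι γ`, `A = ω₁ γ` for a suitable root
of unity `ω₁` (Kronecker: `ε^{1-ι}` is a root of unity for every unit `ε`, and roots of unity are
`q`-th powers) one gets `ν, A, B ∈ 𝓞 K` and a unit `U` with
`x - 1 = π ν`, `A^q = ζ U (1 - ν)`, `B^q = -U (ζ ν + 1)` — so `(A/B)^q = (x - ζ)/(x - ζ⁻¹)`, i.e.
`(x - ζ)^{1-ι}` is a `q`-th power — and `A ≡ -B (mod π)`, `π ∤ B`
([Schoof2009, Proposition 8.1 (i)]: `α ≡ -1 (mod π)`). [cite: Schoof2009, Proposition 8.1] -/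
theorem exists_nu_A_B (hp2 : p ≠ 2) [IsPrincipalIdealRing (𝓞 K)] {x v : ℤ} {q : ℕ} (hq : q.Prime)
    (hqp : q ≠ p) (hq2 : q ≠ 2) (hx1 : x ≠ 1) (hS : ∑ i ∈ range p, x ^ i = p * v ^ q)
    (hpx : (p : ℤ) ∣ x - 1) :
    ∃ (ν A B : 𝓞 K) (U : (𝓞 K)ˣ),
      (x : 𝓞 K) - 1 = (hζ.toInteger - 1) * ν ∧
      A ^ q = hζ.toInteger * U * (1 - ν) ∧
      B ^ q = -U * (hζ.toInteger * ν + 1) ∧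
      hζ.toInteger - 1 ∣ A + B ∧ ¬ hζ.toInteger - 1 ∣ B := by
  classical
  have hp3 : 3 ≤ p := by
    have := hp.out.two_le
    rcases Nat.eq_or_lt_of_le this with h | h
    · exact absurd h.symm hp2
    · omega
  obtain ⟨𝔟, hfac, -, -⟩ := span_sub_zeta_eq hζ hp3 hq.ne_zero hx1 hS hpx
  set ζi : 𝓞 K := hζ.toInteger with hζi
  set π : 𝓞 K := ζi - 1 with hπ
  set ι : Gal(K/ℚ) := gal p K (-1) with hι
  have hπp : Prime π := prime_zeta_sub_one hζ
  have hζp : ζi ^ p = 1 := hζ.toInteger_isPrimitiveRoot.pow_eq_one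
  have hζp' : ζi * ζi ^ (p - 1) = 1 := by
    rw [← pow_succ', Nat.sub_add_cancel hp.out.one_lt.le, hζp]
  -- `𝔟 = (γ)` and `(x - ζ) u = π γ^q`
  obtain ⟨γ, hγ⟩ := (IsPrincipalIdealRing.principal 𝔟).principal
  rw [Ideal.submodule_span_eq] at hγ
  have hspan : Ideal.span {(x : 𝓞 K) - ζi} = Ideal.span {π * γ ^ q} := by
    rw [hfac, hγ, Ideal.span_singleton_pow, Ideal.span_singleton_mul_span_singleton]
  obtain ⟨u, hu⟩ := Ideal.span_singleton_eq_span_singleton.mp hspan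
  -- `x - 1 = π ν` with `π ∣ ν`
  have hπ2x : π ^ 2 ∣ (x : 𝓞 K) - 1 := by
    obtain ⟨w, hw⟩ := hpx
    have : ((x : 𝓞 K)) - 1 = (p : 𝓞 K) * w := by exact_mod_cast congrArg (Int.cast : ℤ → 𝓞 K) hw
    rw [this]
    exact (zeta_sub_one_sq_dvd_p hζ hp3).mul_right _
  obtain ⟨ν, hν⟩ : π ∣ (x : 𝓞 K) - 1 := (dvd_pow_self π two_ne_zero).trans hπ2x
  have hπν : π ∣ ν := by
    rw [hν, sq] at hπ2x
    exact (mul_dvd_mul_iff_left hπp.ne_zero).mp hπ2x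
  have hxζ : (x : 𝓞 K) - ζi = π * (ν - 1) := by rw [mul_sub, ← hν, hπ]; ring
  have hγq : γ ^ q = (u : 𝓞 K) * (ν - 1) := by
    apply mul_left_cancel₀ hπp.ne_zero
    rw [← hu, hxζ]
    ring
  -- `π ∤ γ`
  have hπγ : ¬ π ∣ γ := by
    intro h
    have h1 : π ∣ (u : 𝓞 K) * (ν - 1) := by rw [← hγq]; exact dvd_pow h hq.ne_zero
    have h2 : π ∣ ν - 1 := (hπp.dvd_or_dvd h1).resolve_left
      (fun h3 => hπp.not_unit (isUnit_of_dvd_unit h3 u.isUnit))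
    have : π ∣ ν - (ν - 1) := dvd_sub hπν h2
    rw [sub_sub_cancel] at this
    exact hπp.not_unit (isUnit_of_dvd_one this)
  -- `ι ζ = ζ^{p-1}`, `ι π = -ζ^{p-1} π`, `ι ν = -ζ ν`
  have hιζ : ι • ζi = ζi ^ (p - 1) := by
    rw [hι, hζi, gal_smul_toInteger hζ, val_neg_units, Units.val_one, ZMod.val_one]
  have hιπ : ι • π = -ζi ^ (p - 1) * π := by
    rw [hπ, smul_sub, smul_one, hιζ]
    linear_combination hζp'
  have hιι : ι * ι = 1 := by rw [hι, ← gal_mul, neg_mul_neg, one_mul, gal_one]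
  have hιν : ι • ν = -ζi * ν := by
    have h1 := congrArg (fun t : 𝓞 K => ι • t) hν
    simp only [smul_sub, smul_mul', gal_smul_intCast, smul_one, hιπ] at h1
    rw [hν] at h1
    have h2 : π * (ν + ζi ^ (p - 1) * ι • ν) = 0 := by linear_combination h1
    rcases mul_eq_zero.mp h2 with h3 | h3
    · exact absurd h3 hπp.ne_zero
    · linear_combination ζi * h3 - (ι • ν) * hζp'
  -- `ι u = u η` with `η^{2p} = 1` (Kronecker)
  set uι : (𝓞 K)ˣ := Units.map (MulSemiringAction.toRingHom Gal(K/ℚ) (𝓞 K) ι).toMonoidHom u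
    with huι
  have huι' : (uι : 𝓞 K) = ι • (u : 𝓞 K) := rfl
  set η : (𝓞 K)ˣ := u⁻¹ * uι with hηdef
  have hη : ι • (u : 𝓞 K) = u * η := by
    rw [hηdef, Units.val_mul, ← mul_assoc, Units.mul_inv, one_mul, huι']
  have hη2p : η ^ (2 * p) = 1 := pow_eq_one_of_smul_eq_mul hζ hp2 u.ne_zero hη
  -- `B = ι γ`
  set B : 𝓞 K := ι • γ with hB
  have hBq : B ^ q = -((u : 𝓞 K) * η) * (ζi * ν + 1) := by
    have h1 := congrArg (fun t : 𝓞 K => ι • t) hγq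
    simp only [smul_pow', smul_mul', smul_sub, smul_one, hη, hιν] at h1
    rw [hB, h1]
    ring
  -- the root of unity `ω = -ζ η` and its `q`-th root `ω₁`
  have hζunit : IsUnit ζi := hζ.toInteger_isPrimitiveRoot.isUnit hp.out.ne_zero
  set ζu : (𝓞 K)ˣ := hζunit.unit with hζu
  have hζu' : (ζu : 𝓞 K) = ζi := hζunit.unit_spec
  set ω : (𝓞 K)ˣ := -(ζu * η) with hωdef
  have hω2p : ω ^ (2 * p) = 1 := by
    have hζu2p : ζu ^ (2 * p) = 1 := by
      ext
      rw [Units.val_pow_eq_pow_val, hζu', mul_comm, pow_mul, hζp, one_pow, Units.val_one]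
    rw [hωdef, neg_pow, mul_pow, hζu2p, hη2p, pow_mul, neg_one_sq, one_pow]
    simp
  have h2p : 1 < 2 * p := by have := hp.out.two_le; omega
  have hqcop : q.Coprime (2 * p) := by
    rw [Nat.coprime_mul_iff_right]
    exact ⟨(Nat.coprime_primes hq Nat.prime_two).mpr hq2, (Nat.coprime_primes hq hp.out).mpr hqp⟩
  obtain ⟨k, -, hk⟩ := Nat.exists_mul_mod_eq_one_of_coprime hqcop h2p
  set ω₁ : (𝓞 K)ˣ := ω ^ k with hω₁def
  have hω₁q : ω₁ ^ q = ω := by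
    rw [hω₁def, ← pow_mul, mul_comm, ← Nat.div_add_mod (q * k) (2 * p), hk, pow_add, pow_mul,
      hω2p, one_pow, one_mul, pow_one]
  have hω₁2p : ω₁ ^ (2 * p) = 1 := by
    rw [hω₁def, ← pow_mul, mul_comm, pow_mul, hω2p, one_pow]
  -- `A = ω₁ γ`
  set A : 𝓞 K := (ω₁ : 𝓞 K) * γ with hA
  have hAq : A ^ q = ζi * ((u : 𝓞 K) * η) * (1 - ν) := by
    rw [hA, mul_pow, ← Units.val_pow_eq_pow_val, hω₁q, hγq, hωdef]
    push_cast
    rw [hζu']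
    ring
  -- `A^q - B^q = u η (1 + ζ)` is a unit, so `π ∤ A - B`
  have hAqBq : A ^ q - B ^ q = ((u : 𝓞 K) * η) * (1 + ζi ^ 1) := by rw [hAq, hBq]; ring
  have hunit : IsUnit (A ^ q - B ^ q) := by
    rw [hAqBq]
    exact (u.isUnit.mul η.isUnit).mul (isUnit_one_add_pow hζ hp2 (r := 1)
      (fun h => hp.out.ne_one (Nat.dvd_one.mp h)))
  -- `π ∣ A + B`
  have hApB : π ∣ A + B := by
    have h1 : π ∣ (ω₁ : 𝓞 K) ^ 2 - 1 := by
      have h := dvd_pow_sub_self hζ ((ω₁ : 𝓞 K) ^ 2)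
      rw [← pow_mul, ← Units.val_pow_eq_pow_val, hω₁2p, Units.val_one] at h
      rwa [← dvd_neg, neg_sub] at h
    have h2 : π ∣ B - γ := dvd_gal_smul_sub_self hζ ι γ
    have h3 : π ∣ (A - B) * (A + B) := by
      have e : (A - B) * (A + B) = ((ω₁ : 𝓞 K) ^ 2 - 1) * γ ^ 2 - (B - γ) * (B + γ) := by
        rw [hA]; ring
      rw [e]
      exact dvd_sub (h1.mul_right _) (h2.mul_right _)
    rcases hπp.dvd_or_dvd h3 with h4 | h4
    · exact absurd (isUnit_of_dvd_unit (h4.trans (sub_dvd_pow_sub_pow A B q)) hunit) hπp.not_unit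
    · exact h4
  -- `π ∤ B`
  have hπB : ¬ π ∣ B := by
    intro h
    apply hπγ
    have h1 : ι • π ∣ ι • B := map_dvd (MulSemiringAction.toRingHom Gal(K/ℚ) (𝓞 K) ι) h
    rw [hB, smul_smul, hιι, one_smul, hιπ] at h1
    exact (dvd_mul_left π (-ζi ^ (p - 1))).trans h1
  refine ⟨ν, A, B, u * η, hν, ?_, ?_, hApB, hπB⟩
  · rw [hAq]; push_cast; ring
  · rw [hBq]; push_cast; ring

end Data

/-! ### Proposition 8.2: `q ≡ 1 (mod p)` -/

section StageOne

include hζ in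
/-- **[Schoof2009, Proposition 8.2]**, from the data of `exists_nu_A_B` with `ν = π^n ν₁`, `π ∤ ν₁`,
`n ≥ 2`: `q ≡ 1 (mod p)`. Schoof's `p`-adic proof computes `N(η)` for `η = (w - w')^q`,
`w = (1+μ)^{1/q}`, `w' = w/α = -ζ^r (1 + ιμ)^{1/q}` (`rq ≡ -1 (mod p)`), modulo `(x-1)π`; here `w, w'`
are replaced by `W = q - ν ≈ q·(1-ν)^{1/q}`, `W' = -ζ^r (q + ζν)`: `(BW)^q ≡ (AW')^q (mod ν²)` forces
`BW ≡ AW' (mod π^{2n})` (uniqueness of `q`-th roots), so `(A - B) W ≡ A u (mod π^{2n})` with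
`u = W - W' = (1 + ζ^r)(q + (x-1) s_r (1+ζ^r)⁻¹)`, `s_r = ∑_{k ≤ r} ζ^k`; taking norms,
`±q^{q|G|} ≡ ±N(u)^q ≡ ±q^{q|G|}(1 + (x-1) Tr(d)) (mod π^{2n})`, whence `π ∣ Tr(d)`,
`Tr(d) ≡ (p-1)(r+1)(p+1)/2`, `p ∣ r + 1`, `r = p - 1` and `q ≡ 1 (mod p)`.
[cite: Schoof2009, Proposition 8.2] -/
theorem stage_one (hp2 : p ≠ 2) {q : ℕ} (hq : q.Prime) (hqp : q ≠ p) (hqo : Odd q) {x : ℤ}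
    {ν ν₁ A B : 𝓞 K} {U : (𝓞 K)ˣ} {n : ℕ} (hn : 2 ≤ n)
    (hν : (x : 𝓞 K) - 1 = (hζ.toInteger - 1) * ν) (hν₁ : ν = (hζ.toInteger - 1) ^ n * ν₁)
    (hπν₁ : ¬ hζ.toInteger - 1 ∣ ν₁)
    (hA : A ^ q = hζ.toInteger * U * (1 - ν)) (hB : B ^ q = -U * (hζ.toInteger * ν + 1))
    (hAB : hζ.toInteger - 1 ∣ A + B) (hπB : ¬ hζ.toInteger - 1 ∣ B) : p ∣ q - 1 := by
  classical
  haveI := IsCyclotomicExtension.isGalois {p} ℚ K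
  set ζi : 𝓞 K := hζ.toInteger with hζi
  set π : 𝓞 K := ζi - 1 with hπ
  set g : ℕ := Fintype.card Gal(K/ℚ) with hg
  have hπp : Prime π := prime_zeta_sub_one hζ
  have hζp : ζi ^ p = 1 := hζ.toInteger_isPrimitiveRoot.pow_eq_one
  have hζp' : ζi ^ (p - 1) * ζi = 1 := by rw [← pow_succ, Nat.sub_add_cancel hp.out.one_lt.le, hζp]
  have hp3 : 3 ≤ p := by
    have := hp.out.two_le
    rcases Nat.eq_or_lt_of_le this with h | h
    · exact absurd h.symm hp2
    · omega
  have hq3 : 3 ≤ q := by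
    have := hq.two_le
    rcases Nat.eq_or_lt_of_le this with h | h
    · exfalso; rw [← h] at hqo; exact (Nat.not_odd_iff_even.mpr even_two) hqo
    · omega
  have hg1 : 1 ≤ g := by rw [hg, card_gal (p := p)]; omega
  have hπq : ¬ π ∣ (q : 𝓞 K) :=
    not_dvd_natCast hζ (fun h => hqp ((Nat.prime_dvd_prime_iff_eq hp.out hq).mp h).symm)
  have hπν : π ∣ ν := ⟨π ^ (n - 1) * ν₁, by
    rw [hν₁, ← mul_assoc, ← pow_succ', Nat.sub_add_cancel (by omega)]⟩
  have hx1 : (x : 𝓞 K) - 1 = π ^ (n + 1) * ν₁ := by rw [hν, hν₁, pow_succ']; ring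
  have hπ2n : π ^ (2 * n) ∣ ν ^ 2 := ⟨ν₁ ^ 2, by rw [hν₁, mul_pow, ← pow_mul, mul_comm n 2]⟩
  -- `r` with `r q ≡ -1 (mod p)`
  have hcop : Nat.Coprime q p := (Nat.coprime_primes hq hp.out).mpr hqp
  set qu : (ZMod p)ˣ := ZMod.unitOfCoprime q hcop with hqu
  have hqu' : (q : ZMod p) = (qu : ZMod p) := by rw [hqu, ZMod.coe_unitOfCoprime]
  set r : ℕ := ((-qu⁻¹ : (ZMod p)ˣ) : ZMod p).val with hr
  have hr0 : 0 < r := ZMod.val_pos.mpr (-qu⁻¹).ne_zero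
  have hrp : r < p := ZMod.val_lt _
  have hpr : ¬ p ∣ r := fun h => by have := Nat.le_of_dvd hr0 h; omega
  have hrq : ζi ^ (r * q) = ζi ^ (p - 1) := by
    apply toInteger_pow_eq_pow hζ
    rw [← ZMod.natCast_eq_natCast_iff', Nat.cast_mul, hr, ZMod.natCast_zmod_val, hqu',
      Units.val_neg, neg_mul, ← Units.val_mul, inv_mul_cancel, Units.val_one,
      Nat.cast_sub hp.out.one_lt.le, Nat.cast_one, ZMod.natCast_self, zero_sub]
  -- the Taylor polynomials
  set W : 𝓞 K := (q : 𝓞 K) - ν with hW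
  set W' : 𝓞 K := -(ζi ^ r * ((q : 𝓞 K) + ζi * ν)) with hW'
  obtain ⟨Z₁, hZ₁⟩ := exists_add_pow_eq_order_two (q : 𝓞 K) (-ν) (q - 2)
  obtain ⟨Z₂, hZ₂⟩ := exists_add_pow_eq_order_two (q : 𝓞 K) (ζi * ν) (q - 2)
  rw [show q - 2 + 2 = q by omega, show q - 2 + 1 = q - 1 by omega] at hZ₁ hZ₂
  have hqq : (q : 𝓞 K) * (q : 𝓞 K) ^ (q - 1) = (q : 𝓞 K) ^ q := by
    rw [← pow_succ', Nat.sub_add_cancel (by omega)]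
  have hWq : W ^ q = (q : 𝓞 K) ^ q * (1 - ν) + ν ^ 2 * Z₁ := by
    rw [hW, sub_eq_add_neg, hZ₁]
    linear_combination (-ν) * hqq
  have hW'q : W' ^ q = -(ζi ^ (p - 1) * ((q : 𝓞 K) ^ q * (1 + ζi * ν) + (ζi * ν) ^ 2 * Z₂)) := by
    rw [hW', neg_pow, hqo.neg_one_pow, mul_pow, ← pow_mul, hrq, hZ₂]
    linear_combination (-(ζi ^ (p - 1) * (ζi * ν))) * hqq
  -- the exact relation `B^q (1 - ν) = -ζ^{p-1} A^q (1 + ζ ν)`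
  have hrel : B ^ q * (1 - ν) + ζi ^ (p - 1) * A ^ q * (1 + ζi * ν) = 0 := by
    rw [hA, hB]
    linear_combination ((U : 𝓞 K) * (1 - ν) * (1 + ζi * ν)) * hζp'
  -- `(BW)^q ≡ (AW')^q (mod π^{2n})`, hence `BW ≡ AW'`
  have hXY : π ^ (2 * n) ∣ (B * W) ^ q - (A * W') ^ q := by
    have e : (B * W) ^ q - (A * W') ^ q =
        ν ^ 2 * (B ^ q * Z₁ + A ^ q * ζi ^ (p - 1) * ζi ^ 2 * Z₂) := by
      rw [mul_pow, mul_pow, hW'q, hWq]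
      linear_combination ((q : 𝓞 K) ^ q) * hrel
    rw [e]
    exact hπ2n.mul_right _
  have hπX : ¬ π ∣ B * W := by
    intro h
    rcases hπp.dvd_or_dvd h with h1 | h1
    · exact hπB h1
    · apply hπq
      have := dvd_add h1 hπν
      rwa [hW, sub_add_cancel] at this
  have hXY1 : π ∣ B * W - A * W' := by
    have e : B * W - A * W' = (q : 𝓞 K) * (A + B) + (q : 𝓞 K) * A * (ζi ^ r - 1) - B * ν +
        ζi ^ r * ζi * A * ν := by rw [hW, hW']; ring
    rw [e]
    refine dvd_add (dvd_sub (dvd_add (hAB.mul_left _) ?_) (hπν.mul_left _)) (hπν.mul_left _)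
    exact (sub_one_dvd_pow_sub_one ζi r).mul_left _
  have hHensel := pow_dvd_sub_of_pow_dvd_pow_sub_pow hπp (2 * n) hπq hπX hXY1 hXY
  -- `u = W - W'` and `(A - B) W ≡ A u`
  set u : 𝓞 K := W - W' with hu
  have h1 : π ^ (2 * n) ∣ (A - B) * W - A * u := by
    have e : (A - B) * W - A * u = -(B * W - A * W') := by rw [hu]; ring
    rw [e]
    exact dvd_neg.mpr hHensel
  have hABu : IsUnit (A - B) := by
    have e : A ^ q - B ^ q = (U : 𝓞 K) * (1 + ζi ^ 1) := by rw [hA, hB]; ring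
    have hun : IsUnit (A ^ q - B ^ q) := by
      rw [e]
      exact U.isUnit.mul (isUnit_one_add_pow hζ hp2 (r := 1)
        (fun h => hp.out.ne_one (Nat.dvd_one.mp h)))
    exact isUnit_of_dvd_unit (sub_dvd_pow_sub_pow A B q) hun
  have hζunit : IsUnit ζi := hζ.toInteger_isPrimitiveRoot.isUnit hp.out.ne_zero
  have hA' : A ^ q = ((hζunit.unit * U : (𝓞 K)ˣ) : 𝓞 K) * (1 - ν) := by
    rw [hA, Units.val_mul, hζunit.unit_spec]
  have hWdvd : π ^ (2 * n) ∣ W ^ q - (q : 𝓞 K) ^ q * (1 - ν) := by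
    rw [hWq, add_sub_cancel_left]
    exact hπ2n.mul_right _
  obtain ⟨s, s', hs, hs', hcore⟩ := core hζ h1 hABu hWdvd hA' hπν
  -- `u = (1 + ζ^r)(q + (x-1) d)` with `d = s_r g_r`
  set sr : 𝓞 K := ∑ k ∈ range (r + 1), ζi ^ k with hsr
  set d : 𝓞 K := sr * invOneAdd hζ r with hd
  have hginv := one_add_pow_mul_invOneAdd hζ hp2 hpr
  have hgeom : sr * π = ζi ^ (r + 1) - 1 := by rw [hsr, hπ]; exact geom_sum_mul ζi (r + 1)
  have hueq : u = (1 + ζi ^ r) * ((q : 𝓞 K) + ((x : 𝓞 K) - 1) * d) := by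
    rw [hν, hd, hu, hW, hW']
    linear_combination (-ν) * hgeom - (π * ν * sr) * hginv
  -- norms: `N(u) = N(1 + ζ^r) N(q + (x-1)d)`
  have hs4 : normO (1 + ζi ^ r) = 1 ∨ normO (1 + ζi ^ r) = -1 :=
    normO_of_isUnit (isUnit_one_add_pow hζ hp2 hpr)
  have hexp := pow_dvd_normO_add_mul_sub hζ (a := q) (c := x - 1) (d := d) (k := n + 1)
    (by rw [show ((x - 1 : ℤ) : 𝓞 K) = (x : 𝓞 K) - 1 by push_cast; ring, hx1, mul_assoc]
        exact dvd_mul_right _ _)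
  push_cast at hexp
  rw [← hg] at hexp
  -- abbreviations
  set Q : 𝓞 K := (q : 𝓞 K) ^ g with hQ
  set T : 𝓞 K := traceO d with hT
  set Nq : 𝓞 K := normO ((q : 𝓞 K) + ((x : 𝓞 K) - 1) * d) with hNq
  set z : 𝓞 K := Nq - Q with hz
  -- `π^{n+1} ∣ z`
  have hQq : (q : 𝓞 K) * (q : 𝓞 K) ^ (g - 1) = Q := by
    rw [hQ, ← pow_succ', Nat.sub_add_cancel hg1]
  have hzdvd : π ^ (n + 1) ∣ z := by
    have e : z = (Nq - (Q + (q : 𝓞 K) ^ (g - 1) * ((x : 𝓞 K) - 1) * T)) +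
        (q : 𝓞 K) ^ (g - 1) * ((x : 𝓞 K) - 1) * T := by rw [hz]; ring
    rw [e]
    refine dvd_add ((pow_dvd_pow π (by omega)).trans hexp) ?_
    rw [hx1]
    exact ⟨(q : 𝓞 K) ^ (g - 1) * ν₁ * T, by ring⟩
  -- `N(u)^q`
  obtain ⟨Z₃, hZ₃⟩ := exists_add_pow_eq_order_two Q z (q - 2)
  rw [show q - 2 + 2 = q by omega, show q - 2 + 1 = q - 1 by omega] at hZ₃
  have hQQ : (q : 𝓞 K) * Q ^ (q - 1) * ((q : 𝓞 K) ^ (g - 1)) = Q ^ q := by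
    calc (q : 𝓞 K) * Q ^ (q - 1) * (q : 𝓞 K) ^ (g - 1)
        = Q ^ (q - 1) * ((q : 𝓞 K) * (q : 𝓞 K) ^ (g - 1)) := by ring
      _ = Q ^ (q - 1) * Q := by rw [hQq]
      _ = Q ^ q := by rw [← pow_succ, Nat.sub_add_cancel (by omega)]
  have hNu : normO u = normO (1 + ζi ^ r) * (Q + z) := by
    rw [hueq, normO_mul, show Q + z = Nq by rw [hz]; ring]
  have hNuq : normO u ^ q = normO (1 + ζi ^ r) ^ q *
      (Q ^ q + (q : 𝓞 K) * Q ^ (q - 1) * z + z ^ 2 * Z₃) := by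
    rw [hNu, mul_pow, hZ₃]
  -- `N(q^q) = Q^q`
  have hNqq : normO ((q : 𝓞 K) ^ q) = Q ^ q := by
    rw [normO_pow, normO_natCast, ← hg, hQ]
  -- main congruence: `π^{2n} ∣ s Q^q - s'' Q^q (1 + (x-1) T) + (multiple of π^{2n+2})`
  set s'' : 𝓞 K := s' * normO (1 + ζi ^ r) ^ q with hs''
  have hs''sign : s'' = 1 ∨ s'' = -1 := sign_mul hs' (sign_pow hs4 q)
  have hmain : π ^ (2 * n) ∣ Q ^ q * ((s - s'') - s'' * (((x : 𝓞 K) - 1) * T)) := by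
    -- `hcore : π^{2n} ∣ s N(q^q) - s' N(u)^q`
    have e1 : s * normO ((q : 𝓞 K) ^ q) - s' * normO u ^ q =
        Q ^ q * ((s - s'') - s'' * (((x : 𝓞 K) - 1) * T)) -
        s'' * ((q : 𝓞 K) * Q ^ (q - 1) * (z - (q : 𝓞 K) ^ (g - 1) * ((x : 𝓞 K) - 1) * T)
          + z ^ 2 * Z₃) := by
      rw [hNqq, hNuq, hs'']
      linear_combination (-(s' * normO (1 + ζi ^ r) ^ q * (((x : 𝓞 K) - 1) * T))) * hQQ
    rw [e1] at hcore
    have h2 : π ^ (2 * n) ∣ s'' * ((q : 𝓞 K) * Q ^ (q - 1) *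
        (z - (q : 𝓞 K) ^ (g - 1) * ((x : 𝓞 K) - 1) * T) + z ^ 2 * Z₃) := by
      refine Dvd.dvd.mul_left (dvd_add (Dvd.dvd.mul_left ?_ _) ?_) _
      · have e2 : z - (q : 𝓞 K) ^ (g - 1) * ((x : 𝓞 K) - 1) * T =
            Nq - (Q + (q : 𝓞 K) ^ (g - 1) * ((x : 𝓞 K) - 1) * T) := by rw [hz]; ring
        rw [e2]
        exact (pow_dvd_pow π (by omega)).trans hexp
      · have h3 : π ^ ((n + 1) * 2) ∣ z ^ 2 := by rw [pow_mul]; exact pow_dvd_pow_of_dvd hzdvd 2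
        exact ((pow_dvd_pow π (by omega)).trans h3).mul_right _
    have := dvd_add hcore h2
    rwa [sub_add_cancel] at this
  have hπQ : ¬ π ∣ Q ^ q := fun h => hπq (hπp.dvd_of_dvd_pow (hπp.dvd_of_dvd_pow (hQ ▸ h)))
  have hmain' := hπp.pow_dvd_of_dvd_mul_left (2 * n) hπQ hmain
  -- the signs agree
  have hss : s = s'' := by
    apply sign_eq_of_dvd_sub hζ hp2 hs hs''sign
    have h1 : π ∣ (s - s'') - s'' * (((x : 𝓞 K) - 1) * T) := (dvd_pow_self π (by omega)).trans hmain'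
    have h2 : π ∣ s'' * (((x : 𝓞 K) - 1) * T) := by
      rw [hν]
      exact ⟨s'' * (ν * T), by ring⟩
    have := dvd_add h1 h2
    rwa [sub_add_cancel] at this
  -- hence `π^{2n} ∣ (x - 1) T = π^{n+1} ν₁ T`, so `π ∣ T`
  have hT1 : π ∣ T := by
    rw [hss, sub_self, zero_sub, dvd_neg] at hmain'
    have h1 : π ^ (2 * n) ∣ ((x : 𝓞 K) - 1) * T := by
      have := hmain'.mul_left s''
      rwa [← mul_assoc, sign_mul_self hs''sign, one_mul] at this
    rw [hx1, mul_assoc] at h1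
    have h2 : π ^ (n - 1) ∣ ν₁ * T := by
      have e : π ^ (2 * n) = π ^ (n + 1) * π ^ (n - 1) := by rw [← pow_add]; congr 1; omega
      rw [e] at h1
      exact (mul_dvd_mul_iff_left (pow_ne_zero _ hπp.ne_zero)).mp h1
    have h3 := hπp.pow_dvd_of_dvd_mul_left (n - 1) hπν₁ h2
    exact (dvd_pow_self π (by omega)).trans h3
  -- `T ≡ (p-1)(r+1)(p+1)/2 (mod π)`
  have hT2 : π ∣ (((p - 1) * ((r + 1) * ((p + 1) / 2)) : ℕ) : 𝓞 K) := by
    have h1 : π ∣ T - (p - 1 : ℕ) * d := dvd_traceO_sub hζ d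
    have h2 : π ∣ d - ((r + 1 : ℕ) : 𝓞 K) * (((p + 1) / 2 : ℕ) : 𝓞 K) := by
      have h3 : π ∣ sr - (r + 1 : ℕ) := by
        rw [hsr]
        exact dvd_sum_zeta_pow_sub hζ (r + 1) id
      have h4 : π ∣ invOneAdd hζ r - ((p + 1) / 2 : ℕ) := dvd_invOneAdd_sub hζ r
      have e : d - ((r + 1 : ℕ) : 𝓞 K) * (((p + 1) / 2 : ℕ) : 𝓞 K) =
          (sr - (r + 1 : ℕ)) * invOneAdd hζ r + ((r + 1 : ℕ) : 𝓞 K) *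
            (invOneAdd hζ r - ((p + 1) / 2 : ℕ)) := by rw [hd]; ring
      rw [e]
      exact dvd_add (h3.mul_right _) (h4.mul_left _)
    have e : (((p - 1) * ((r + 1) * ((p + 1) / 2)) : ℕ) : 𝓞 K) =
        T - (T - (p - 1 : ℕ) * d) - (p - 1 : ℕ) * (d - ((r + 1 : ℕ) : 𝓞 K) *
          (((p + 1) / 2 : ℕ) : 𝓞 K)) := by push_cast; ring
    rw [e]
    exact dvd_sub (dvd_sub hT1 h1) (h2.mul_left _)
  -- so `p ∣ (p-1)(r+1)(p+1)/2`, i.e. `p ∣ r + 1`, `r = p - 1`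
  have hp_dvd : p ∣ (p - 1) * ((r + 1) * ((p + 1) / 2)) := by
    have := (dvd_intCast_iff hζ ((p - 1) * ((r + 1) * ((p + 1) / 2)) : ℕ)).mp (by exact_mod_cast hT2)
    exact_mod_cast this
  have hpr1 : p ∣ r + 1 := by
    rcases (Nat.Prime.dvd_mul hp.out).mp hp_dvd with h | h
    · exfalso; have := Nat.le_of_dvd (by omega) h; omega
    · rcases (Nat.Prime.dvd_mul hp.out).mp h with h' | h'
      · exact h'
      · exfalso
        have := Nat.le_of_dvd (by omega) h'
        omega
  have hr_eq : r = p - 1 := by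
    obtain ⟨c, hc⟩ := hpr1
    have hc1 : c = 1 := by
      rcases Nat.lt_or_ge c 2 with h2 | h2
      · interval_cases c
        · omega
        · rfl
      · nlinarith
    subst hc1
    omega
  -- `-q⁻¹ = -1` in `(ℤ/p)ˣ`, so `q ≡ 1 (mod p)`
  have hqu1 : (q : ZMod p) = 1 := by
    have h1 : ((-qu⁻¹ : (ZMod p)ˣ) : ZMod p) = -1 := by
      rw [← ZMod.natCast_zmod_val ((-qu⁻¹ : (ZMod p)ˣ) : ZMod p), ← hr, hr_eq,
        Nat.cast_sub hp.out.one_lt.le, Nat.cast_one, ZMod.natCast_self, zero_sub]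
    have h2 : qu⁻¹ = 1 := by
      ext
      rw [Units.val_neg] at h1
      rw [Units.val_one]
      exact neg_injective h1
    rw [hqu', ← inv_inv qu, h2, inv_one, Units.val_one]
  have hmod : q % p = 1 % p := (ZMod.natCast_eq_natCast_iff' q 1 p).mp (by exact_mod_cast hqu1)
  exact (Nat.modEq_iff_dvd' hq.one_lt.le).mp hmod.symm

end StageOne

/-! ### Theorem 8.3: the contradiction -/

section StageTwo

include hζ in
/-- **[Schoof2009, Theorem 8.3] (the second-order computation).** With the data of `exists_nu_A_B`,
`ν = π^n ν₁`, `π ∤ ν₁`, `n ≥ 2`, `q ≡ 1 (mod p)` (Proposition 8.2) and `(p-1)(q-1) ≤ n + 1`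
(Cassels: `p^{q-1} ∣ x - 1`), there is a contradiction when `p ≥ 5`. Now (`r = -1`) the linear
Taylor terms cancel; with the order-three polynomials `V(t) = 2q² + 2qt + (1-q)t²`
(`V(t)^q ≡ (2q²)^q (1+t) (mod t³)`), `W = V(-ν)`, `W' = -ζ⁻¹ V(ζν)` one gets `BW ≡ AW' (mod π^{3n})`,
`u = W - W' = (1 + ζ⁻¹)(2q² + (1-q) ζ ν²)`, and the norm computation gives
`π^{3n} ∣ (1-q) Tr(ζν²)`; as `12 Tr(ζ ν²) = (1 - p²)(x-1)²` ([Schoof2009, Exercise 8.4]: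
`∑ ζ/(1-ζ)² = (1-p²)/12`), `π^{n-2} ∣ (q-1)(p²-1)`, so `p^{q-1} ∣ q - 1`, impossible.
[cite: Schoof2009, Theorem 8.3] -/
theorem stage_two (hp5 : 5 ≤ p) {q : ℕ} (hq : q.Prime) (hqp : q ≠ p) (hqo : Odd q) {x : ℤ}
    {ν ν₁ A B : 𝓞 K} {U : (𝓞 K)ˣ} {n : ℕ} (hn : 2 ≤ n) (hbig : (p - 1) * (q - 1) ≤ n + 1)
    (hpq : p ∣ q - 1)
    (hν : (x : 𝓞 K) - 1 = (hζ.toInteger - 1) * ν) (hν₁ : ν = (hζ.toInteger - 1) ^ n * ν₁)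
    (hπν₁ : ¬ hζ.toInteger - 1 ∣ ν₁)
    (hA : A ^ q = hζ.toInteger * U * (1 - ν)) (hB : B ^ q = -U * (hζ.toInteger * ν + 1))
    (hAB : hζ.toInteger - 1 ∣ A + B) (hπB : ¬ hζ.toInteger - 1 ∣ B) : False := by
  classical
  haveI := IsCyclotomicExtension.isGalois {p} ℚ K
  have hp2 : p ≠ 2 := by omega
  set ζi : 𝓞 K := hζ.toInteger with hζi
  set π : 𝓞 K := ζi - 1 with hπ
  set g : ℕ := Fintype.card Gal(K/ℚ) with hg
  have hπp : Prime π := prime_zeta_sub_one hζ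
  have hζp : ζi ^ p = 1 := hζ.toInteger_isPrimitiveRoot.pow_eq_one
  have hζp' : ζi ^ (p - 1) * ζi = 1 := by rw [← pow_succ, Nat.sub_add_cancel hp.out.one_lt.le, hζp]
  have hq3 : 3 ≤ q := by
    have := hq.two_le
    rcases Nat.eq_or_lt_of_le this with h | h
    · exfalso; rw [← h] at hqo; exact (Nat.not_odd_iff_even.mpr even_two) hqo
    · omega
  have hg1 : 1 ≤ g := by rw [hg, card_gal (p := p)]; omega
  have hπq : ¬ π ∣ (q : 𝓞 K) :=
    not_dvd_natCast hζ (fun h => hqp ((Nat.prime_dvd_prime_iff_eq hp.out hq).mp h).symm)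
  have hπ2 : ¬ π ∣ (2 : 𝓞 K) := not_dvd_two hζ hp2
  have hπν : π ∣ ν := ⟨π ^ (n - 1) * ν₁, by
    rw [hν₁, ← mul_assoc, ← pow_succ', Nat.sub_add_cancel (by omega)]⟩
  have hx1 : (x : 𝓞 K) - 1 = π ^ (n + 1) * ν₁ := by rw [hν, hν₁, pow_succ']; ring
  have hπ2n : π ^ (2 * n) ∣ ν ^ 2 := ⟨ν₁ ^ 2, by rw [hν₁, mul_pow, ← pow_mul, mul_comm n 2]⟩
  have hπ3n : π ^ (3 * n) ∣ ν ^ 3 := ⟨ν₁ ^ 3, by rw [hν₁, mul_pow, ← pow_mul, mul_comm n 3]⟩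
  -- `ζ^{(p-1) q} = ζ^{p-1}` as `q ≡ 1 (mod p)`
  have hζpq : ζi ^ ((p - 1) * q) = ζi ^ (p - 1) := by
    apply toInteger_pow_eq_pow hζ
    obtain ⟨c, hc⟩ := hpq
    have hq' : q = p * c + 1 := by omega
    rw [hq', show (p - 1) * (p * c + 1) = (p - 1) + p * ((p - 1) * c) by ring,
      Nat.add_mul_mod_self_left]
  -- the order-three Taylor polynomials
  set X : 𝓞 K := 2 * (q : 𝓞 K) ^ 2 with hX
  obtain ⟨R₁, hR₁⟩ := exists_taylor_three_pow (R := 𝓞 K) hq.two_le (-ν)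
  obtain ⟨R₂, hR₂⟩ := exists_taylor_three_pow (R := 𝓞 K) hq.two_le (ζi * ν)
  push_cast at hR₁ hR₂
  rw [← hX] at hR₁ hR₂
  set W : 𝓞 K := X + 2 * (q : 𝓞 K) * (-ν) + (1 - (q : 𝓞 K)) * (-ν) ^ 2 with hW
  set W' : 𝓞 K := -(ζi ^ (p - 1) * (X + 2 * (q : 𝓞 K) * (ζi * ν) + (1 - (q : 𝓞 K)) * (ζi * ν) ^ 2))
    with hW'
  have hWq : W ^ q = X ^ q * (1 - ν) + (-ν) ^ 3 * R₁ := by rw [hW, hR₁]; ring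
  have hW'q : W' ^ q = -(ζi ^ (p - 1) * (X ^ q * (1 + ζi * ν) + (ζi * ν) ^ 3 * R₂)) := by
    rw [hW', neg_pow, hqo.neg_one_pow, mul_pow, ← pow_mul, hζpq, hR₂]
    ring
  -- the exact relation
  have hrel : B ^ q * (1 - ν) + ζi ^ (p - 1) * A ^ q * (1 + ζi * ν) = 0 := by
    rw [hA, hB]
    linear_combination ((U : 𝓞 K) * (1 - ν) * (1 + ζi * ν)) * hζp'
  -- `(BW)^q ≡ (AW')^q (mod π^{3n})`, hence `BW ≡ AW'`
  have hXY : π ^ (3 * n) ∣ (B * W) ^ q - (A * W') ^ q := by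
    have e : (B * W) ^ q - (A * W') ^ q =
        ν ^ 3 * (-(B ^ q * R₁) + A ^ q * ζi ^ (p - 1) * ζi ^ 3 * R₂) := by
      rw [mul_pow, mul_pow, hW'q, hWq]
      linear_combination (X ^ q) * hrel
    rw [e]
    exact hπ3n.mul_right _
  have hπXX : ¬ π ∣ X := by
    intro h
    rw [hX] at h
    rcases hπp.dvd_or_dvd h with h1 | h1
    · exact hπ2 h1
    · exact hπq (hπp.dvd_of_dvd_pow h1)
  have hπX : ¬ π ∣ B * W := by
    intro h
    rcases hπp.dvd_or_dvd h with h1 | h1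
    · exact hπB h1
    · apply hπXX
      have e : X = W - ν * (-(2 * (q : 𝓞 K)) + (1 - (q : 𝓞 K)) * ν) := by rw [hW]; ring
      rw [e]
      exact dvd_sub h1 (hπν.mul_right _)
  have hXY1 : π ∣ B * W - A * W' := by
    have e : B * W - A * W' = X * (A + B) + X * A * (ζi ^ (p - 1) - 1) +
        ν * (-(2 * (q : 𝓞 K)) * B + (1 - (q : 𝓞 K)) * B * ν + 2 * (q : 𝓞 K) * A * ζi ^ (p - 1) * ζi
          + (1 - (q : 𝓞 K)) * A * ζi ^ (p - 1) * ζi ^ 2 * ν) := by rw [hW, hW']; ring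
    rw [e]
    refine dvd_add (dvd_add (hAB.mul_left _) ?_) (hπν.mul_right _)
    exact (sub_one_dvd_pow_sub_one ζi (p - 1)).mul_left _
  have hHensel := pow_dvd_sub_of_pow_dvd_pow_sub_pow hπp (3 * n) hπq hπX hXY1 hXY
  -- `u = W - W'` and `(A - B) W ≡ A u`
  set u : 𝓞 K := W - W' with hu
  have h1 : π ^ (3 * n) ∣ (A - B) * W - A * u := by
    have e : (A - B) * W - A * u = -(B * W - A * W') := by rw [hu]; ring
    rw [e]
    exact dvd_neg.mpr hHensel
  have hABu : IsUnit (A - B) := by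
    have e : A ^ q - B ^ q = (U : 𝓞 K) * (1 + ζi ^ 1) := by rw [hA, hB]; ring
    have hun : IsUnit (A ^ q - B ^ q) := by
      rw [e]
      exact U.isUnit.mul (isUnit_one_add_pow hζ hp2 (r := 1)
        (fun h => hp.out.ne_one (Nat.dvd_one.mp h)))
    exact isUnit_of_dvd_unit (sub_dvd_pow_sub_pow A B q) hun
  have hζunit : IsUnit ζi := hζ.toInteger_isPrimitiveRoot.isUnit hp.out.ne_zero
  have hA' : A ^ q = ((hζunit.unit * U : (𝓞 K)ˣ) : 𝓞 K) * (1 - ν) := by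
    rw [hA, Units.val_mul, hζunit.unit_spec]
  have hWdvd : π ^ (3 * n) ∣ W ^ q - X ^ q * (1 - ν) := by
    rw [hWq, add_sub_cancel_left, neg_pow]
    exact (hπ3n.mul_left _).mul_right _
  obtain ⟨s, s', hs, hs', hcore⟩ := core hζ h1 hABu hWdvd hA' hπν
  -- `u = (1 + ζ^{p-1})(X + (1 - q) ζ ν²)`
  have hp1 : ¬ p ∣ p - 1 := fun h => by have := Nat.le_of_dvd (by omega) h; omega
  have hueq : u = (1 + ζi ^ (p - 1)) * (X + (1 - (q : 𝓞 K)) * (ζi * ν ^ 2)) := by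
    rw [hu, hW, hW']
    linear_combination (2 * (q : 𝓞 K) * ν - (1 - (q : 𝓞 K)) * ν ^ 2 * (1 - ζi)) * hζp'
  have hs4 : normO (1 + ζi ^ (p - 1)) = 1 ∨ normO (1 + ζi ^ (p - 1)) = -1 :=
    normO_of_isUnit (isUnit_one_add_pow hζ hp2 hp1)
  set d : 𝓞 K := ζi * ν ^ 2 with hd
  have hdd : π ^ (2 * n) ∣ d := hπ2n.mul_left _
  have hexp := pow_dvd_normO_add_mul_sub hζ (a := 2 * q ^ 2) (c := 1 - q) (d := d) (k := 2 * n)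
    (by push_cast; exact hdd.mul_left _)
  push_cast at hexp
  rw [← hg, ← hX] at hexp
  -- abbreviations
  set Q : 𝓞 K := X ^ g with hQ
  set T : 𝓞 K := traceO d with hT
  set Nq : 𝓞 K := normO (X + (1 - (q : 𝓞 K)) * d) with hNq
  set z : 𝓞 K := Nq - Q with hz
  have hTdvd : π ^ (2 * n) ∣ T := pow_dvd_traceO hζ hdd
  have hzdvd : π ^ (2 * n) ∣ z := by
    have e : z = (Nq - (Q + X ^ (g - 1) * (1 - (q : 𝓞 K)) * T)) + X ^ (g - 1) * (1 - (q : 𝓞 K)) * T := by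
      rw [hz]; ring
    rw [e]
    exact dvd_add ((pow_dvd_pow π (by omega)).trans hexp) (hTdvd.mul_left _)
  -- `N(u)^q`
  obtain ⟨Z₃, hZ₃⟩ := exists_add_pow_eq_order_two Q z (q - 2)
  rw [show q - 2 + 2 = q by omega, show q - 2 + 1 = q - 1 by omega] at hZ₃
  have hNu : normO u = normO (1 + ζi ^ (p - 1)) * (Q + z) := by
    rw [hueq, normO_mul, show Q + z = Nq by rw [hz]; ring]
  have hNuq : normO u ^ q = normO (1 + ζi ^ (p - 1)) ^ q *
      (Q ^ q + (q : 𝓞 K) * Q ^ (q - 1) * z + z ^ 2 * Z₃) := by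
    rw [hNu, mul_pow, hZ₃]
  have hNXq : normO (X ^ q) = Q ^ q := by
    have hNX : normO X = Q := by
      have := normO_natCast (K := K) (2 * q ^ 2)
      push_cast at this
      rw [hQ, hg, hX]
      exact this
    rw [normO_pow, hNX]
  -- main congruence
  set s'' : 𝓞 K := s' * normO (1 + ζi ^ (p - 1)) ^ q with hs''
  have hs''sign : s'' = 1 ∨ s'' = -1 := sign_mul hs' (sign_pow hs4 q)
  have hmain : π ^ (3 * n) ∣ Q ^ q * (s - s'') -
      s'' * ((q : 𝓞 K) * Q ^ (q - 1) * (X ^ (g - 1) * (1 - (q : 𝓞 K)) * T)) := by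
    have e1 : s * normO (X ^ q) - s' * normO u ^ q =
        (Q ^ q * (s - s'') - s'' * ((q : 𝓞 K) * Q ^ (q - 1) * (X ^ (g - 1) * (1 - (q : 𝓞 K)) * T))) -
        s'' * ((q : 𝓞 K) * Q ^ (q - 1) * (z - X ^ (g - 1) * (1 - (q : 𝓞 K)) * T) + z ^ 2 * Z₃) := by
      rw [hNXq, hNuq, hs'']
      ring
    rw [e1] at hcore
    have h2 : π ^ (3 * n) ∣ s'' * ((q : 𝓞 K) * Q ^ (q - 1) *
        (z - X ^ (g - 1) * (1 - (q : 𝓞 K)) * T) + z ^ 2 * Z₃) := by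
      refine Dvd.dvd.mul_left (dvd_add (Dvd.dvd.mul_left ?_ _) ?_) _
      · have e2 : z - X ^ (g - 1) * (1 - (q : 𝓞 K)) * T =
            Nq - (Q + X ^ (g - 1) * (1 - (q : 𝓞 K)) * T) := by rw [hz]; ring
        rw [e2]
        exact (pow_dvd_pow π (by omega)).trans hexp
      · have h3 : π ^ ((2 * n) * 2) ∣ z ^ 2 := by rw [pow_mul]; exact pow_dvd_pow_of_dvd hzdvd 2
        exact ((pow_dvd_pow π (by omega)).trans h3).mul_right _
    have := dvd_add hcore h2
    rwa [sub_add_cancel] at this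
  -- the signs agree
  have hπQ : ¬ π ∣ Q := fun h => hπXX (hπp.dvd_of_dvd_pow (hQ ▸ h))
  have hss : s = s'' := by
    apply sign_eq_of_dvd_sub hζ hp2 hs hs''sign
    have h1 : π ∣ Q ^ q * (s - s'') := by
      have h2 : π ∣ Q ^ q * (s - s'') -
          s'' * ((q : 𝓞 K) * Q ^ (q - 1) * (X ^ (g - 1) * (1 - (q : 𝓞 K)) * T)) :=
        (dvd_pow_self π (by omega)).trans hmain
      have h3 : π ∣ s'' * ((q : 𝓞 K) * Q ^ (q - 1) * (X ^ (g - 1) * (1 - (q : 𝓞 K)) * T)) :=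
        ((((dvd_pow_self π (by omega)).trans hTdvd).mul_left _).mul_left _).mul_left _
      have := dvd_add h2 h3
      rwa [sub_add_cancel] at this
    exact (hπp.dvd_or_dvd h1).resolve_left (fun h => hπQ (hπp.dvd_of_dvd_pow h))
  -- hence `π^{3n} ∣ (1 - q) T`
  have hT1 : π ^ (3 * n) ∣ (1 - (q : 𝓞 K)) * T := by
    rw [hss, sub_self, mul_zero, zero_sub, dvd_neg] at hmain
    have e : s'' * ((q : 𝓞 K) * Q ^ (q - 1) * (X ^ (g - 1) * (1 - (q : 𝓞 K)) * T)) =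
        (s'' * (q : 𝓞 K) * Q ^ (q - 1) * X ^ (g - 1)) * ((1 - (q : 𝓞 K)) * T) := by ring
    rw [e] at hmain
    refine hπp.pow_dvd_of_dvd_mul_left _ ?_ hmain
    intro h
    rcases hπp.dvd_or_dvd h with h1 | h1
    · rcases hπp.dvd_or_dvd h1 with h2 | h2
      · rcases hπp.dvd_or_dvd h2 with h3 | h3
        · rcases hs''sign with h4 | h4 <;> rw [h4] at h3
          · exact hπp.not_unit (isUnit_of_dvd_one h3)
          · exact hπp.not_unit (isUnit_of_dvd_one (dvd_neg.mp h3))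
        · exact hπq h3
      · exact hπQ (hπp.dvd_of_dvd_pow h2)
    · exact hπXX (hπp.dvd_of_dvd_pow h1)
  -- `12 T = (1 - p²)(x - 1)²`
  have htr : 12 * T = (1 - (p : 𝓞 K) ^ 2) * ((x : 𝓞 K) - 1) ^ 2 := by
    have hδ := zeta_sub_one_mul_delta hζ
    have hid := traceO_zeta_mul_delta_sq hζ
    have e1 : ((p ^ 2 : ℕ) : 𝓞 K) * d = (((x - 1) ^ 2 : ℤ) : 𝓞 K) * (ζi * delta hζ ^ 2) := by
      push_cast
      rw [hd, hν, ← hδ]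
      ring
    have e2 := congrArg traceO e1
    rw [traceO_natCast_mul, traceO_intCast_mul] at e2
    push_cast at e2
    have hp0 : (p : 𝓞 K) ^ 2 ≠ 0 := pow_ne_zero _ (Nat.cast_ne_zero.mpr hp.out.ne_zero)
    apply mul_left_cancel₀ hp0
    rw [hT]
    linear_combination 12 * e2 + ((x : 𝓞 K) - 1) ^ 2 * hid
  -- so `π^{n-2} ∣ (q-1)(p²-1)`
  have hN : π ^ (n - 2) ∣ (((q - 1) * (p ^ 2 - 1) : ℕ) : 𝓞 K) := by
    have h1 : π ^ (3 * n) ∣ 12 * ((1 - (q : 𝓞 K)) * T) := hT1.mul_left _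
    have e : 12 * ((1 - (q : 𝓞 K)) * T) = π ^ (2 * n + 2) *
        ((((q - 1) * (p ^ 2 - 1) : ℕ) : 𝓞 K) * ν₁ ^ 2) := by
      rw [show 12 * ((1 - (q : 𝓞 K)) * T) = (1 - (q : 𝓞 K)) * (12 * T) by ring, htr, hx1]
      push_cast [Nat.cast_sub hq.one_lt.le, Nat.cast_sub (Nat.one_le_pow 2 p hp.out.pos)]
      ring
    rw [e, show 3 * n = (2 * n + 2) + (n - 2) by omega, pow_add] at h1
    have h2 := (mul_dvd_mul_iff_left (pow_ne_zero _ hπp.ne_zero)).mp h1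
    exact hπp.pow_dvd_of_dvd_mul_right _ (fun h => hπν₁ (hπp.dvd_of_dvd_pow h)) h2
  have hp21 : 1 < p ^ 2 := Nat.one_lt_pow two_ne_zero hp.out.one_lt
  have hN0 : (q - 1) * (p ^ 2 - 1) ≠ 0 := Nat.mul_ne_zero (by omega) (by omega)
  have hval := le_mul_padicValNat_of_pow_dvd hζ hN0 hN
  haveI := Fact.mk hp.out
  have hvp : padicValNat p ((q - 1) * (p ^ 2 - 1)) = padicValNat p (q - 1) := by
    rw [padicValNat.mul (by omega) (by omega), padicValNat.eq_zero_of_not_dvd (n := p ^ 2 - 1), add_zero]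
    intro h
    have h1 : p ∣ p ^ 2 := dvd_pow_self p two_ne_zero
    have h2 : p ∣ p ^ 2 - (p ^ 2 - 1) := Nat.dvd_sub h1 h
    rw [Nat.sub_sub_self (Nat.one_le_pow 2 p hp.out.pos)] at h2
    exact hp.out.ne_one (Nat.dvd_one.mp h2)
  rw [hvp] at hval
  set e := padicValNat p (q - 1) with he
  -- `q - 1 ≤ e`, so `p^{q-1} ∣ q - 1`: impossible
  have hqe : q - 1 ≤ e := by
    by_contra hlt
    have h1 : (p - 1) * (e + 1) ≤ (p - 1) * (q - 1) := Nat.mul_le_mul_left _ (by omega)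
    rw [Nat.mul_succ] at h1
    have hval' : n ≤ (p - 1) * e + 2 := by omega
    have h4 : 4 ≤ p - 1 := by omega
    omega
  have hdvd : p ^ (q - 1) ∣ q - 1 := (pow_dvd_pow p hqe).trans pow_padicValNat_dvd
  have hle : p ^ (q - 1) ≤ q - 1 := Nat.le_of_dvd (by omega) hdvd
  have hlt : q - 1 < 2 ^ (q - 1) := Nat.lt_two_pow_self
  have hle2 : 2 ^ (q - 1) ≤ p ^ (q - 1) := Nat.pow_le_pow_left hp.out.two_le _
  omega

end StageTwo

end WithZeta

/-! ### Corollary 8.4 (PID case) and Theorem IV for `3` and `5` -/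

section Final

/-- **[Schoof2009, Corollary 8.4] for principal `ℤ[ζ_p]`**: let `p ≥ 5` be a prime such that the ring
of integers of the `p`-th cyclotomic field is a principal ideal domain, and `q` an odd prime. Then
`x^p - y^q = 1` has no solution in non-zero integers. (Cassels' Corollary 6.5 supplies
`(x - ζ) = π𝔟^q`, `p^{q-1} ∣ x - 1`; Proposition 8.1 the data `A, B`; Proposition 8.2 gives
`q ≡ 1 (mod p)` and Theorem 8.3 the contradiction.) [cite: Schoof2009, Corollary 8.4, Theorem 8.3] -/
theorem no_solution_of_isPrincipalIdealRing {p : ℕ} [hp : Fact p.Prime] (hp5 : 5 ≤ p)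
    (K : Type*) [Field K] [NumberField K] [IsCyclotomicExtension {p} ℚ K]
    [IsPrincipalIdealRing (𝓞 K)] {q : ℕ} (hq : q.Prime) (hqo : Odd q) {x y : ℤ} (hx : x ≠ 0)
    (hy : y ≠ 0) (h : x ^ p - y ^ q = 1) : False := by
  classical
  have hζ := IsCyclotomicExtension.zeta_spec p ℚ K
  have hp2 : p ≠ 2 := by omega
  have hpo : Odd p := hp.out.odd_of_ne_two hp2
  have hq2 : q ≠ 2 := fun h2 => by rw [h2] at hqo; exact (Nat.not_odd_iff_even.mpr even_two) hqo
  have hqp : q ≠ p := by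
    rintro rfl
    exact pow_sub_pow_ne_one hqo (by have := hq.two_le; omega) hx hy h
  obtain ⟨a, v, h1, hS, -, -, -⟩ := cassels_padic hp.out hq hpo hqo hx hy h
  have hx1 : x ≠ 1 := by
    rintro rfl
    rw [one_pow, sub_eq_iff_eq_add] at h
    have : y ^ q = 0 := by linarith
    exact hy (pow_eq_zero_iff hq.ne_zero |>.mp this)
  have hpx : (p : ℤ) ∣ x - 1 := by
    refine ⟨(p : ℤ) ^ (q - 2) * a ^ q, ?_⟩
    rw [h1, show q - 1 = (q - 2) + 1 by have := hq.two_le; omega, pow_succ]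
    ring
  obtain ⟨ν, A, B, U, hν, hA, hB, hAB, hπB⟩ := exists_nu_A_B hζ hp2 hq hqp hq2 hx1 hS hpx
  set π : 𝓞 K := hζ.toInteger - 1 with hπ
  have hπp : Prime π := prime_zeta_sub_one hζ
  -- `ν = π^n ν₁` with `π ∤ ν₁`
  have hν0 : ν ≠ 0 := by
    intro h0
    rw [h0, mul_zero, sub_eq_zero] at hν
    exact hx1 (by exact_mod_cast hν)
  obtain ⟨n, ν₁, hπν₁, hν₁⟩ := WfDvdMonoid.max_power_factor hν0 hπp.irreducible
  -- `π^{(p-1)(q-1)} ∣ x - 1 = π^{n+1} ν₁`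
  have hbig : (p - 1) * (q - 1) ≤ n + 1 := by
    obtain ⟨ε, hε⟩ := IsCyclotomicExtension.Rat.associated_zeta_sub_one_pow_prime p hζ
    have h2 : π ^ ((p - 1) * (q - 1)) ∣ (x : 𝓞 K) - 1 := by
      have e : (x : 𝓞 K) - 1 = ((p : 𝓞 K)) ^ (q - 1) * (a : 𝓞 K) ^ q := by exact_mod_cast congrArg (Int.cast : ℤ → 𝓞 K) h1
      rw [e, ← hε, mul_pow, ← pow_mul, mul_assoc]
      exact dvd_mul_right _ _
    rw [hν, hν₁, ← mul_assoc, ← pow_succ'] at h2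
    have h3 := hπp.pow_dvd_of_dvd_mul_right _ hπν₁ h2
    rwa [pow_dvd_pow_iff hπp.ne_zero hπp.not_unit] at h3
  have hn : 2 ≤ n := by
    have : 4 * 2 ≤ (p - 1) * (q - 1) := Nat.mul_le_mul (by omega) (by have := hq.two_le; omega)
    omega
  have hpq := stage_one hζ hp2 hq hqp hqo hn hν hν₁ hπν₁ hA hB hAB hπB
  exact stage_two hζ hp5 hq hqp hqo hn hbig hpq hν hν₁ hπν₁ hA hB hAB hπB

/-- **Mihăilescu's Theorem IV for the primes `3` and `5`** [Schoof2009, Theorem IV; p. 52]: if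
`p, q` are odd primes and `x, y` non-zero integers with `x^p - y^q = 1`, then `p ≥ 7` and `q ≥ 7`.
(`3` is excluded by Nagell's theorem, `5` by Corollary 8.4 since `ℤ[ζ_5]` is a PID — for `q = 5` via
the solution `(-y)^q - (-x)^p = 1`.) [cite: Schoof2009, Theorem IV (Ch. 8, pp. 51–52)] -/
theorem seven_le {p q : ℕ} (hp : p.Prime) (hq : q.Prime) (hpo : Odd p) (hqo : Odd q) {x y : ℤ}
    (hx : x ≠ 0) (hy : y ≠ 0) (h : x ^ p - y ^ q = 1) : 7 ≤ p ∧ 7 ≤ q := by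
  obtain ⟨hp5, hq5⟩ := Nagell.five_le hp hq hpo hqo hx hy h
  have h' : (-y) ^ q - (-x) ^ p = 1 := by rw [hqo.neg_pow, hpo.neg_pow]; linarith
  haveI : Fact (Nat.Prime 5) := ⟨Nat.prime_five⟩
  haveI : IsCyclotomicExtension {5} ℚ (CyclotomicField 5 ℚ) :=
    CyclotomicField.instIsCyclotomicExtensionSingletonNatSetOfCharZero 5 ℚ
  haveI : NumberField (CyclotomicField 5 ℚ) := IsCyclotomicExtension.numberField {5} ℚ _
  haveI := IsCyclotomicExtension.Rat.five_pid (CyclotomicField 5 ℚ)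
  have hp5' : p ≠ 5 := by
    rintro rfl
    exact no_solution_of_isPrincipalIdealRing (p := 5) le_rfl (CyclotomicField 5 ℚ) hq hqo hx hy h
  have hq5' : q ≠ 5 := by
    rintro rfl
    exact no_solution_of_isPrincipalIdealRing (p := 5) le_rfl (CyclotomicField 5 ℚ) hp hpo
      (neg_ne_zero.mpr hy) (neg_ne_zero.mpr hx) h'
  have hp6 : p ≠ 6 := by rintro rfl; exact (Nat.not_odd_iff_even.mpr (by decide)) hpo
  have hq6 : q ≠ 6 := by rintro rfl; exact (Nat.not_odd_iff_even.mpr (by decide)) hqo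
  constructor <;> omega

end Final

end Catalan.PiAdic

end Literature.NumberTheory.DiophantineGeometry
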